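import Literature.Claims.NS.Kyritsis2021
import Literature.Analysis.FluidPDE.GavrilovSteadyEulerProofs
import Literature.Analysis.FluidPDE.TaoLocalisation
import Literature.Analysis.FluidPDE.NSLerayHopfSereginEnergyProofs
import HarnessLib
import Literature.Uncategorized.Step5PairCone

/-!
# NS-claims map, C03b (Kyritsis 2021): kernel checks of the typed proof skeleton
# `Literature.Claims.NS.Kyritsis2021`

Negation of a step of the typed skeleton by an explicit countermodel satisfying the typed
hypotheses of that step (print locators: K. E. Kyritsis, «A short and simple solution of the
millennium problem about the Navier Stokes equations and similarly for the Euler equations»,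
preprint 2021, the text typed as `Literature.Claims.NS.Kyritsis2021`):

* `not_Step_5` — eqs. (34)–(35), p. 20, and their repetition (37), p. 21, the INTERMEDIATE of the
  printed proof of PROP 5.1 (skeleton decl `Step_5`, consumed by the kernel composition
  `step6_of_steps`): «W = c·V·|p(x₂) − p(x₁)| ≤ E(t)» for the double circular cone with vertices
  `x₁ ≠ x₂` and ANY base radius `R > 0`, for every solution in the class, `ν ≥ 0` («Navier-Stokes …
  or Euler»). Countermodel inside the typed scope (`ν = 0`): Gavrilov's compactly supported smooth
  steady Euler flow `(U, P)` on `ℝ³` (tree theorem `gavrilov_compact_steady_euler_holds`; GAFA 29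
  (2019) 190–197), read as the time-independent classical solution `u(t) = U`, `p(t) = P` on
  `[0, 1)`: it is in the class (its slices are `C^∞_c`, so every Sobolev norm is bounded; tree
  `HasRapidSpatialDecay.of_hasCompactSupport`, `….hasBoundedSobolevNormsOn_const`) and has
  finite energy `E = ½ ∫ |U|²`. Its pressure is not constant — the virial identity
  `3 ∫ P = −∫ |U|² < 0` (whole-space integration by parts of `(U·∇)U + ∇P = 0` against the position
  field; tree `integral_inner_convect_add_eq_zero`, `integral_mul_divergence_add_eq_zero_left`)
  gives a point with `P ≠ 0`, compact support a point with `P = 0` — while the cone volume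
  `πR²‖x₂ − x₁‖/3` is unbounded in `R`: with `R` chosen so that `W = E + 1` the printed inequality
  fails.
* `not_Step5PairCone` — the referee's charitable one-cone-per-pair retype R#D of the same display
  (base radius `R = ‖x₂ − x₁‖`; `Step5PairCone` below): false by the same flow, sending the second
  vertex to infinity through the zero set of the compactly supported pressure.

Axioms: `propext`, `Classical.choice`, `Quot.sound` only (no `native_decide`).
WHAT THIS IS NOT: not a claim about NS regularity or blow-up; not a claim about any author beyond
the typed locator.
-/

noncomputable section

open Real Set Function MeasureTheory InnerProductSpace
open Literature.Analysis.FluidPDE Literature.Claims.NS.Kyritsis2021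
open scoped ContDiff ENNReal RealInnerProductSpace

-- The summit's canonical theorem namespace repeats the summit name (single-conjunct summit).
set_option linter.dupNamespace false

namespace Summit.NavierStokesRegularity.NavierStokesRegularity.Theorems.Kyritsis2021

/-! ## Toolkit: smooth compactly supported steady Euler pairs -/

/-- A smooth steady Euler pair `(U, P)` on `ℝ³` — `div U = 0`, `(U·∇)U + ∇P = 0` — with `U`
compactly supported, read as the time-independent pair `u(t) = U`, `p(t) = P`, is a solution of the
Euler equations (`ν = 0`, `f = 0`) in the class of Props 3.1–3.2 on every `[0, T)`: jointly smooth,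
`∂ₜu = 0`, and all spatial Sobolev norms bounded (tree
`HasRapidSpatialDecay.hasBoundedSobolevNormsOn_const`). [folklore] -/
theorem isLocalClassSolution_steady {U : EuclideanSpace ℝ (Fin 3) → EuclideanSpace ℝ (Fin 3)}
    {P : EuclideanSpace ℝ (Fin 3) → ℝ} (hU : ContDiff ℝ ∞ U) (hP : ContDiff ℝ ∞ P)
    (hUc : HasCompactSupport U) (hdiv : VectorCalculus.IsDivFree U)
    (hE : ∀ x, convect U U x + gradient P x = 0) (T : ℝ) :
    IsLocalClassSolution 0 T (fun _ => U) (fun _ => P) := by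
  refine ⟨⟨?_, ?_, ?_, ?_⟩, fun T'' _ => ?_⟩
  · exact (hU.comp contDiff_snd).contDiffOn
  · exact (hP.comp contDiff_snd).contDiffOn
  · intro t _ x
    rw [show convect U U x = -gradient P x from eq_neg_of_add_eq_zero_left (hE x)]
    simp [timeDerivWithin_apply]
  · exact fun _ _ => hdiv
  · exact (HasRapidSpatialDecay.of_hasCompactSupport hU hUc).hasBoundedSobolevNormsOn_const _

/-- The energy `½ ∫ |U|²` of the time-independent field `u(t) = U`, `U ∈ C^∞_c`, is finite.
[folklore] -/
theorem energy_const_lt_top {U : EuclideanSpace ℝ (Fin 3) → EuclideanSpace ℝ (Fin 3)}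
    (hU : ContDiff ℝ ∞ U) (hUc : HasCompactSupport U) (t : ℝ) :
    energy (fun _ => U) t < ⊤ := by
  have h :=
    (HasRapidSpatialDecay.of_hasCompactSupport hU hUc).lintegral_enorm_iteratedFDeriv_sq_lt_top
      (μ := volume) 0
  have h' : (∫⁻ x, ‖iteratedFDeriv ℝ 0 U x‖ₑ ^ 2) = ∫⁻ x, ‖U x‖ₑ ^ 2 := by
    refine lintegral_congr fun x => ?_
    rw [← ofReal_norm, norm_iteratedFDeriv_zero, ofReal_norm]
  rw [h'] at h
  unfold energy
  exact ENNReal.mul_lt_top (by simp) h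

/-- **Virial identity.** For a smooth steady Euler pair `(U, P)` with `U`, `P` compactly supported,
`3 ∫ P = −∫ |U|²`: test `(U·∇)U + ∇P = 0` against the position field `x ↦ x` and integrate by
parts over the whole space (no boundary terms) — `∫ ⟪x, (U·∇)U⟫ = −∫ ⟪(U·∇)x, U⟫ − ∫ (div U)⟪x, U⟫
= −∫ |U|²` and `∫ ⟪x, ∇P⟫ = −∫ P div x = −3 ∫ P`. [folklore] -/
theorem three_mul_integral_pressure_eq
    {U : EuclideanSpace ℝ (Fin 3) → EuclideanSpace ℝ (Fin 3)}
    {P : EuclideanSpace ℝ (Fin 3) → ℝ} (hU : ContDiff ℝ ∞ U) (hP : ContDiff ℝ ∞ P)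
    (hUc : HasCompactSupport U) (hPc : HasCompactSupport P) (hdiv : VectorCalculus.IsDivFree U)
    (hE : ∀ x, convect U U x + gradient P x = 0) :
    3 * ∫ x, P x = -∫ x, ⟪U x, U x⟫ := by
  have hU1 : ContDiff ℝ 1 U := hU.of_le (by exact_mod_cast le_top)
  have hP1 : ContDiff ℝ 1 P := hP.of_le (by exact_mod_cast le_top)
  have hid : ContDiff ℝ 1 (fun x : EuclideanSpace ℝ (Fin 3) => x) := contDiff_id
  have h1 := integral_inner_convect_add_eq_zero (u := U)
    (v := fun x : EuclideanSpace ℝ (Fin 3) => x) (w := U) hU1 hid hU1 hUc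
  have h2 := integral_mul_divergence_add_eq_zero_left (θ := P)
    (u := fun x : EuclideanSpace ℝ (Fin 3) => x) hP1 hid hPc
  have hconv_id : ∀ x, convect U (fun x : EuclideanSpace ℝ (Fin 3) => x) x = U x := fun x => by
    simp [convect]
  have hconv : ∀ x, convect U U x = -gradient P x := fun x => eq_neg_of_add_eq_zero_left (hE x)
  have hdiv' : ∀ x, VectorCalculus.divergence U x = 0 := hdiv
  have hdiv_id : ∀ x : EuclideanSpace ℝ (Fin 3),
      VectorCalculus.divergence (fun x : EuclideanSpace ℝ (Fin 3) => x) x = 3 := fun x => by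
    rw [VectorCalculus.divergence, fderiv_fun_id, ContinuousLinearMap.coe_id, LinearMap.trace_id,
      finrank_euclideanSpace_fin]
    norm_num
  simp only [hconv_id, hconv, hdiv', hdiv_id, inner_neg_right, integral_neg, zero_mul,
    integral_zero, add_zero, integral_mul_const] at h1 h2
  linarith

/-- The pressure of a NONTRIVIAL smooth compactly supported steady Euler pair is not identically
zero (`∫ |U|² > 0` in the virial identity). [folklore] -/
theorem exists_pressure_ne_zero {U : EuclideanSpace ℝ (Fin 3) → EuclideanSpace ℝ (Fin 3)}
    {P : EuclideanSpace ℝ (Fin 3) → ℝ} (hU : ContDiff ℝ ∞ U) (hP : ContDiff ℝ ∞ P)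
    (hUc : HasCompactSupport U) (hPc : HasCompactSupport P) (hU0 : U ≠ 0)
    (hdiv : VectorCalculus.IsDivFree U) (hE : ∀ x, convect U U x + gradient P x = 0) :
    ∃ x, P x ≠ 0 := by
  by_contra h
  push Not at h
  have hP0 : (∫ x, P x) = 0 := by simp [h]
  obtain ⟨x₀, hx₀⟩ := Function.ne_iff.mp hU0
  have hpos : 0 < ∫ x, ⟪U x, U x⟫ := by
    refine Continuous.integral_pos_of_hasCompactSupport_nonneg_nonzero (x := x₀)
      (hU.continuous.inner hU.continuous)
      (hUc.mono fun x hx => by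
        contrapose! hx; simp [notMem_support.1 hx])
      (fun x => real_inner_self_nonneg) ?_
    exact inner_self_ne_zero.2 hx₀
  have := three_mul_integral_pressure_eq hU hP hUc hPc hdiv hE
  linarith

/-- A compactly supported function on `ℝ³` vanishes at points of arbitrarily large norm (at any
point outside a ball about `0` containing its topological support). [folklore] -/
theorem exists_eq_zero_of_hasCompactSupport {P : EuclideanSpace ℝ (Fin 3) → ℝ}
    (hPc : HasCompactSupport P) (M : ℝ) : ∃ x, M ≤ ‖x‖ ∧ P x = 0 := by
  obtain ⟨r, hr⟩ := hPc.isCompact.isBounded.subset_closedBall (0 : EuclideanSpace ℝ (Fin 3))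
  have hn : ‖(|r| + |M| + 1) • EuclideanSpace.single (0 : Fin 3) (1 : ℝ)‖ = |r| + |M| + 1 := by
    rw [norm_smul, PiLp.norm_single, norm_one, mul_one, Real.norm_eq_abs, abs_of_pos (by positivity)]
  refine ⟨(|r| + |M| + 1) • EuclideanSpace.single (0 : Fin 3) (1 : ℝ), ?_,
    image_eq_zero_of_notMem_tsupport fun hx => ?_⟩
  · rw [hn]
    linarith [le_abs_self M, abs_nonneg r]
  · have h := hr hx
    rw [Metric.mem_closedBall, dist_zero_right, hn] at h
    linarith [le_abs_self r, abs_nonneg M]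

/-! ## The refutation -/

/-- **`Step_5` is false** (eqs. (34)–(35) p. 20 / (37) p. 21 of the printed proof of PROP 5.1, as
typed: `V · |p(x₂,t) − p(x₁,t)| ≤ E(t)` for EVERY base radius `R > 0` of the double cone on
`x₁ ≠ x₂`, every solution in the class, `ν ≥ 0`). Countermodel: Gavrilov's compactly supported
steady Euler flow as a time-independent solution in the class (`ν = 0`, `T = 1`, `t = 0`), two
points with different pressures, and the base radius `R = √(3(E+1)/(π‖x₂ − x₁‖·|Δp|))`, for
which the cone work equals `E + 1 > E`. [cite: Kyritsis2021b, eqs. (34)–(35) p. 20 and (37) p. 21] -/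
theorem not_Step_5 : ¬ Literature.Claims.NS.Kyritsis2021.Step_5 := by
  intro h5
  obtain ⟨U, P, hU, hP, hUc, hPc, hU0, hdiv, hE, -⟩ :=
    gavrilov_compact_steady_euler_holds.exists_orthogonal
  obtain ⟨x₂, hx₂⟩ := exists_pressure_ne_zero hU hP hUc hPc hU0 hdiv hE
  obtain ⟨x₁, -, hx₁⟩ := exists_eq_zero_of_hasCompactSupport hPc 0
  have h12 : x₁ ≠ x₂ := fun h => hx₂ (h ▸ hx₁)
  have hd : 0 < |P x₂ - P x₁| := by
    rw [hx₁, sub_zero]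
    exact abs_pos.mpr hx₂
  have hL : 0 < ‖x₂ - x₁‖ := norm_pos_iff.mpr (sub_ne_zero.mpr (Ne.symm h12))
  have hEtop : energy (fun _ : ℝ => U) 0 ≠ ⊤ := (energy_const_lt_top hU hUc 0).ne
  set e : ℝ := (energy (fun _ : ℝ => U) 0).toReal with he_def
  have he : 0 ≤ e := ENNReal.toReal_nonneg
  set R : ℝ := Real.sqrt (3 * (e + 1) / (Real.pi * ‖x₂ - x₁‖ * |P x₂ - P x₁|)) with hR_def
  have hRpos : 0 < R := Real.sqrt_pos.mpr (by positivity)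
  have hW : coneWork (fun _ : ℝ => P) 0 x₁ x₂ R = e + 1 := by
    simp only [coneWork, doubleConeVolume]
    rw [hR_def, Real.sq_sqrt (by positivity)]
    field_simp
  have h := h5 0 le_rfl 1 one_pos (fun _ : ℝ => U) (fun _ : ℝ => P)
    (isLocalClassSolution_steady hU hP hUc hdiv hE 1) 0 ⟨le_rfl, one_pos⟩ x₁ x₂ h12 R hRpos
  rw [hW, ENNReal.ofReal_le_iff_le_toReal hEtop] at h
  linarith

/-! ## The one-cone-per-pair retype (referee ns-claims-ref-2, RETYPE.md R#D) -/

/-- **R#D is false as well**: in Gavrilov's steady flow fix a point `x₁` with `P x₁ ≠ 0` and send the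
second vertex to infinity through the zero set of the compactly supported `P` — the pressure
difference stays `|P x₁|` while the cone volume `(π/3)‖x₂ − x₁‖³` is unbounded. [folklore] -/
theorem not_Step5PairCone : ¬ Literature.Uncategorized.Step5PairCone := by
  intro h5
  obtain ⟨U, P, hU, hP, hUc, hPc, hU0, hdiv, hE, -⟩ :=
    gavrilov_compact_steady_euler_holds.exists_orthogonal
  obtain ⟨x₁, hx₁⟩ := exists_pressure_ne_zero hU hP hUc hPc hU0 hdiv hE
  have hd : 0 < |P x₁| := abs_pos.mpr hx₁
  have hEtop : energy (fun _ : ℝ => U) 0 ≠ ⊤ := (energy_const_lt_top hU hUc 0).ne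
  set e : ℝ := (energy (fun _ : ℝ => U) 0).toReal with he_def
  have he : 0 ≤ e := ENNReal.toReal_nonneg
  set L₀ : ℝ := max 1 (3 * (e + 1) / (Real.pi * |P x₁|)) with hL₀_def
  obtain ⟨x₂, hx₂M, hx₂⟩ := exists_eq_zero_of_hasCompactSupport hPc (‖x₁‖ + L₀)
  have hL : L₀ ≤ ‖x₂ - x₁‖ := by linarith [norm_sub_norm_le x₂ x₁]
  have hL1 : 1 ≤ ‖x₂ - x₁‖ := le_trans (le_max_left _ _) hL
  have h12 : x₁ ≠ x₂ := by
    intro h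
    rw [h, sub_self, norm_zero] at hL1
    linarith
  have hkey : 3 * (e + 1) / (Real.pi * |P x₁|) ≤ ‖x₂ - x₁‖ ^ 2 * ‖x₂ - x₁‖ :=
    le_trans (le_trans (le_max_right _ _) hL) (by nlinarith)
  rw [div_le_iff₀ (by positivity)] at hkey
  have hW : e + 1 ≤ coneWork (fun _ : ℝ => P) 0 x₁ x₂ ‖x₂ - x₁‖ := by
    simp only [coneWork, doubleConeVolume]
    rw [hx₂, zero_sub, abs_neg]
    have : Real.pi * ‖x₂ - x₁‖ ^ 2 * ‖x₂ - x₁‖ / 3 * |P x₁| =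
        ‖x₂ - x₁‖ ^ 2 * ‖x₂ - x₁‖ * (Real.pi * |P x₁|) / 3 := by ring
    rw [this]
    linarith
  have h := h5 0 le_rfl 1 one_pos (fun _ : ℝ => U) (fun _ : ℝ => P)
    (isLocalClassSolution_steady hU hP hUc hdiv hE 1) 0 ⟨le_rfl, one_pos⟩ x₁ x₂ h12
  rw [ENNReal.ofReal_le_iff_le_toReal hEtop] at h
  linarith

end Summit.NavierStokesRegularity.NavierStokesRegularity.Theorems.Kyritsis2021

end
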